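import Literature.Computability.Complexity.Rossman2008
import HarnessLib

/-!
# Route NegLimited — door support `FlipProbLeSum` (line `correlation-door`, stub 2; rung F-N1/p3, ROUND-8 §B / ROUND-9)

Registered stub `stub_flipProbLeSum` of the skeleton `correlation-door` on the door item
`NegLimited.NeglimitedEpsLogNegationsR` (stmt-PneNP-19860; HOME/pnp-ideate-p3/r9/Skeleton-R9-door.lean):
the UNION BOUND for Rossman's planted-clique flip probability under a pointwise cover.  If every flip
of `f` along a planted pair `(x, x ∪ K_A)` (`|A| = k`) is a flip of some member of the list `L`, then
`plantFlipProb m k q f ≤ Σ_{g ∈ L} plantFlipProb m k q g`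
(`plantFlipProb`, `plantClique`, `gnpWeight` of `Literature/Computability/Complexity/Rossman2008.lean`).
Proof: unfold `plantFlipProb = (m choose k)⁻¹ Σ_A Σ_x [f flips]·gnpWeight`, compare the indicators
pointwise (`[f flips at (A,x)]·w ≤ Σ_{g ∈ L} [g flips at (A,x)]·w`, all terms `≥ 0`), and swap the list
sum with the two finite sums.  Used by the proved composition `PlantedNegationTransfer_of` of the
skeleton (cover + union bound ⟹ Rossman's negation-limited transfer lemma for the planted pair).
-/

set_option linter.dupNamespace false -- `Summit.PneNP.PneNP.…`: summit = sub-problem name (D-0017 single-conjunct layout)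

namespace Summit.PneNP.PneNP.Theorems.NegLimitedDoor

open Finset
open Literature.Computability.Complexity

/-- The union bound under the planted coupling (statement verbatim from the registered skeleton): if
every flip of `f` along a planted pair is a flip of some member of `L`, then
`plantFlipProb f ≤ Σ_{g ∈ L} plantFlipProb g`. -/
def FlipProbLeSum : Prop :=
  ∀ (m k : ℕ) (q : ℝ), 0 ≤ q → q ≤ 1 →
    ∀ (f : (↥(⊤ : SimpleGraph (Fin m)).edgeSet → Bool) → Bool)
      (L : List ((↥(⊤ : SimpleGraph (Fin m)).edgeSet → Bool) → Bool)),
      (∀ A ∈ powersetCard k (univ : Finset (Fin m)), ∀ x, f x ≠ f (plantClique A x) →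
        ∃ g ∈ L, g x ≠ g (plantClique A x)) →
      plantFlipProb m k q f ≤ (L.map (plantFlipProb m k q)).sum

/-! ### List-sum bookkeeping -/

/-- A list sum of nonnegative terms is nonnegative. -/
theorem list_sum_map_nonneg {α : Type*} (L : List α) (φ : α → ℝ) (h : ∀ a ∈ L, 0 ≤ φ a) :
    0 ≤ (L.map φ).sum := by
  induction L with
  | nil => simp
  | cons a L ih =>
    simp only [List.map_cons, List.sum_cons]
    exact add_nonneg (h a (by simp)) (ih fun b hb => h b (by simp [hb]))

/-- A member of a list of nonnegative terms is at most the sum. -/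
theorem le_list_sum_map_of_mem {α : Type*} (L : List α) (φ : α → ℝ) (h : ∀ a ∈ L, 0 ≤ φ a)
    {a : α} (ha : a ∈ L) : φ a ≤ (L.map φ).sum := by
  induction L with
  | nil => simp at ha
  | cons b L ih =>
    simp only [List.map_cons, List.sum_cons]
    rcases List.mem_cons.1 ha with rfl | ha'
    · have := list_sum_map_nonneg L φ fun c hc => h c (by simp [hc])
      linarith
    · have h1 := ih (fun c hc => h c (by simp [hc])) ha'
      have h2 : 0 ≤ φ b := h b (by simp)
      linarith

/-- A list sum of finite sums is the finite sum of the list sums. -/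
theorem list_sum_map_finset_sum {α β : Type*} (L : List α) (s : Finset β) (F : α → β → ℝ) :
    (L.map fun a => ∑ b ∈ s, F a b).sum = ∑ b ∈ s, (L.map fun a => F a b).sum := by
  induction L with
  | nil => simp
  | cons a L ih => simp only [List.map_cons, List.sum_cons, ih, sum_add_distrib]

/-! ### The stub -/

/-- **Stub 2 of line `correlation-door` PROVED** (`FlipProbLeSum`, by name): the union bound for
`plantFlipProb` under a pointwise cover of the flips. -/
theorem stub_flipProbLeSum : FlipProbLeSum := by
  intro m k q hq0 hq1 f L hcov
  -- `plantFlipProb g = c⁻¹ · S g` with `S g = Σ_A Σ_x T g A x`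
  set c : ℝ := ((m.choose k : ℕ) : ℝ)⁻¹ with hc
  set T := (fun (g : ((⊤ : SimpleGraph (Fin m)).edgeSet → Bool) → Bool) (A : Finset (Fin m))
      (x : (⊤ : SimpleGraph (Fin m)).edgeSet → Bool) =>
    if g x = g (plantClique A x) then (0 : ℝ) else gnpWeight m q x) with hT
  have hT0 : ∀ g A x, 0 ≤ T g A x := fun g A x => by
    simp only [hT]
    split_ifs
    · exact le_rfl
    · exact gnpWeight_nonneg hq0 hq1 x
  have hpf : ∀ g, plantFlipProb m k q g =
      c * ∑ A ∈ powersetCard k (univ : Finset (Fin m)), ∑ x, T g A x := fun g => rfl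
  -- pointwise comparison of the indicators
  have hpt : ∀ A ∈ powersetCard k (univ : Finset (Fin m)), ∀ x,
      T f A x ≤ (L.map fun g => T g A x).sum := by
    intro A hA x
    by_cases hfx : f x = f (plantClique A x)
    · have : T f A x = 0 := by simp only [hT]; rw [if_pos hfx]
      rw [this]
      exact list_sum_map_nonneg L _ fun g _ => hT0 g A x
    · obtain ⟨g, hgL, hg⟩ := hcov A hA x hfx
      have h1 : T f A x = gnpWeight m q x := by simp only [hT]; rw [if_neg hfx]
      have h2 : T g A x = gnpWeight m q x := by simp only [hT]; rw [if_neg hg]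
      rw [h1, ← h2]
      exact le_list_sum_map_of_mem L _ (fun g' _ => hT0 g' A x) hgL
  -- assemble
  have hc0 : 0 ≤ c := inv_nonneg.2 (Nat.cast_nonneg _)
  have hsum : (L.map (plantFlipProb m k q)).sum =
      c * ∑ A ∈ powersetCard k (univ : Finset (Fin m)), ∑ x, (L.map fun g => T g A x).sum := by
    have h1 : (L.map (plantFlipProb m k q)) =
        L.map (fun g => c * ∑ A ∈ powersetCard k (univ : Finset (Fin m)), ∑ x, T g A x) :=
      List.map_congr_left fun g _ => hpf g
    rw [h1, List.sum_map_mul_left, list_sum_map_finset_sum]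
    congr 1
    exact sum_congr rfl fun A _ => list_sum_map_finset_sum L _ _
  rw [hpf f, hsum]
  refine mul_le_mul_of_nonneg_left ?_ hc0
  exact sum_le_sum fun A hA => sum_le_sum fun x _ => hpt A hA x

end Summit.PneNP.PneNP.Theorems.NegLimitedDoor
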